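import Summits.QuantumFields.YangMills.Theorems.UnitScaleTiltProp8FlatProp4Background1
import HarnessLib

/-!
# Route `UnitScaleTilt`, crux K1 child «MinimiserStabilityRegPr» (stmt-QuantumFields-19200), registered stub V2′ `stub_halvingStep` (v8 5b4e846794b80374 ∕ v10
# `BirthV10`) — pillar P3b, THE CHART-DRESSING COMPOSITION OF [Balaban1985Variational] PROPOSITION 4: **(98) FOR THE FULL `W = (δ/δA′)V`, `V(A′) = V₀(A′ − HD(A′)) +
# (the (85)–(89) terms)`, FROM (98) FOR THE PURE-ACTION GRADIENT `W₀ = (δ/δA)V₀` (✓ `FlatProp4Bg1.exists_gradient_prop4_bg1_T3`, p596336), THE CHART SHIFT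
# `A′ ↦ A′ − HD(A′)` OF PROPOSITION 3 ((47), (55); pillars P2 ∕ P3a, F4 `FlatChart47Levels.chart47W`), AND A DISPLAYED QUADRATIC LETTER FOR THE DRESSING TERMS** —
# in pillar F4's level-weighted pointwise currency (arbitrary finite index types `ι` ∕ `κ`, `src tgt : κ → ι`, weights `w₀, w₁, w₃`; `FlatSmallSolution158Levels`), so
# that both the one-level carrier (`existsUnique_smallSolution158_T3`) and the cube sequence (`existsUnique_smallSolution158_dom`) read it by `rfl`

Cell `ym3-torus` (HUMAN RULING D-0037, YM ladder rung R3 — continuum SU(2) YM₃ on the torus is a RUNG, not the Clay problem), width seat `ym-ust-19200-w5` gen 2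
(OWNER g25 APPROVAL 02:19:01Z, item (iii) «the P3b residual as the honest composition schema»).  `--supports stmt-QuantumFields-19200 --as helper`; def-free, 0 sorry,
standard axioms.  NOTHING of Bałaban's estimates for the dressing terms is proved here: the letters of `H` ((46)), of `D(A′)` ((55)) and of the (85)–(89) terms
(`ΔH = Q*((QGQ*)⁻¹ − a)` on the slice `R∂*H = 0`, [5] (3.132); `δD/δA′` (73); `H*`) are DISPLAYED hypotheses.

THE PRINT (T. Bałaban, CMP **102** (1985) 277–309; journal page = PDF page + 276).  p. 290 (80): *«V(A′) = −⟨HD₃(A′), J⟩ − ⟨A′, ΔHD(A′)⟩ + ½⟨HD(A′), ΔHD(A′)⟩ +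
V₀(A′ − HD(A′)). It is analytic in A′ …»*; (84)–(89) pp. 290–291 (the functional derivatives of the first three terms, estimated by `O(1)ε₃²(L^jη)⁻³`); (90) ff.
(the `V₀` term); p. 292–293 Prop. 4: *«The functional derivative of V(A′) is an analytic function on this space, and satisfies … |(δ/δA′)V(A′)|₍₋₃₎ ≤
C₄(max{|A′|₍₋₁₎, |∇A′|₍₋₂₎})² (98) … valid if max{…} ≤ a₃»*; p. 302 (Sect. F, background 1, `J = 0`): *«𝔊(A′) = ½⟨A′ − HD(A′), ∂*∂(A′ − HD(A′))⟩ + V₀(A′ − HD(A′))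
(157) … all the operators in this section are taken without any external gauge field»*; (55) p. 286: *«|D(A′)| ≤ 4C₂|A′|²»*; (46) p. 285.

WHAT THIS FILE PROVES (finite `ι κ β′`, `src tgt : κ → ι`, weights `w₀ w₃ : ι → ℝ`, `w₁ : κ → ℝ`; «size of `Y` ≤ r» := `w₀ i‖Y i‖ ≤ r ∀ i ∧ w₁ p‖Y(tgt p) −
Y(src p)‖ ≤ r ∀ p`; «current size of `f` ≤ β» := `w₃ i‖f i‖ ≤ β ∀ i`):
* §1 `exists_size_lt` — on finite index types an OPEN size bound `< a` is witnessed by a closed one `≤ r` with `r < a` (the passage (115)-open-ball → F4's `r < a₃`).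
* §2 the chart shift `Ψ(Y) = Y − H(D(Y))`: **`size_chartShift_le`** — `size(Y) ≤ r ≤ R₀`, (55) `‖D(Y)(c)‖ ≤ 4C₂r²` below `R`, (46) `size(HX) ≤ B_H·sup‖X‖` ⟹
  `size(Y − H(D Y)) ≤ (1 + 4B_HC₂R₀)·r` (print p. 293: *«the image … is contained in the set of A′ satisfying (77) with 3ε₃ instead of ε₃»*);
  `mapsTo_chartShift` (open balls), `differentiableOn_chartShift` (`H` linear, `D` holomorphic).
* §3 **`hWq_of_dressing`** — for `W Y = W₀(Y − H(D Y)) + E Y`: (98) for `W₀` (constant `C₀`, radius `a₀`) ∧ §2's data ∧ a quadratic letter `C_E` for `E` below `R₀` ⟹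
  (98) for `W` with `C₄ = C₀(1 + 4B_HC₂R₀)² + C_E` at every radius `a₃ ≤ R₀` with `(1 + 4B_HC₂R₀)a₃ ≤ a₀` — LITERALLY the `hWq` shape of F4
  `FlatSmallSolution158Levels.existsUnique_smallSolution158W`; **`hWd_of_dressing`** — the `hWd` shape (holomorphy on the open `a₃`-ball) from those of `W₀`, `D`, `E`.
* §4 **`exists_dressed_gradient_T3`** — AT THE d = 3 CARRIER (`ι = PBond (F.P K) 0`, `w₀ = w₃ = 1`, `w₁ = L^{K−n}`): P3b's pure-action gradient `W₀` (✓ `exists_gradient_prop4_bg1_T3`: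
  `a₀ = ½`, `C₀ = 18000`) dressed by any `H`, `D`, `E` as above yields `W` with `hWq`∕`hWd` EXACTLY as consumed by `FlatSmallSolution158.existsUnique_smallSolution158_T3`,
  `a₃ = min{R₀, 1/(4(1 + 4B_HC₂R₀))}`, `C₄ = 18000(1 + 4B_HC₂R₀)² + C_E`, member-uniform.
HONEST SCOPE: (i) `E` stands for the SUM of the (85)–(89) gradients (`−ΔH·D(A′)`, `−(δD/δA′)*H*[∂*∂(A′ − HD) + W₀(A′ − HD)]` at `J = 0`); that each is quadratically
small with an L-only constant is print's pp. 290–291 over pillar P2's letters and is NOT proved here; (ii) the identification of `W` with the gradient of Sect. F's `𝔊 −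
½⟨·, ∂*∂·⟩` through the pairing `η^dΣ_b tr` is the P5 assembler's; (iii) NOT a claim about the stub, the crux, the rung or the mass gap.

References: T. Bałaban, CMP **102** (1985) 277–309 [Balaban1985Variational] (46)–(47) p.285, (55) p.286, (80)–(89) pp.290–291, Prop. 4 (97)–(98) pp.292–293,
(157)–(158) p.302.
-/

set_option autoImplicit false

noncomputable section

open Set
open scoped Matrix.Norms.L2Operator

namespace Summit.QuantumFields.YangMills.Theorems.FlatProp4Dressing

open Literature.MathematicalPhysics.QuantumFieldTheory.Balaban1983to89

/-! ## §1 Open size bounds on finite index types -/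

section Finite

variable {ι κ : Type*} [Fintype ι] [Fintype κ]

/-- On finite index types, `f i < a ∀ i` and `g p < a ∀ p` are witnessed by a common closed bound `r < a` (take the maximum of the finitely many values and
`a − 1`). [folklore] -/
theorem exists_size_lt (f : ι → ℝ) (g : κ → ℝ) {a : ℝ} (hf : ∀ i, f i < a) (hg : ∀ p, g p < a) :
    ∃ r : ℝ, r < a ∧ (∀ i, f i ≤ r) ∧ ∀ p, g p ≤ r := by
  classical
  let s : Finset ℝ := insert (a - 1) (Finset.univ.image f ∪ Finset.univ.image g)
  have hs : s.Nonempty := ⟨a - 1, Finset.mem_insert_self _ _⟩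
  refine ⟨s.max' hs, ?_, fun i => ?_, fun p => ?_⟩
  · refine (Finset.max'_lt_iff s hs).2 fun x hx => ?_
    rcases Finset.mem_insert.1 hx with rfl | hx
    · linarith
    · rcases Finset.mem_union.1 hx with hx | hx
      · obtain ⟨i, -, rfl⟩ := Finset.mem_image.1 hx; exact hf i
      · obtain ⟨p, -, rfl⟩ := Finset.mem_image.1 hx; exact hg p
  · exact s.le_max' _ (Finset.mem_insert_of_mem (Finset.mem_union_left _ (Finset.mem_image_of_mem f (Finset.mem_univ i))))
  · exact s.le_max' _ (Finset.mem_insert_of_mem (Finset.mem_union_right _ (Finset.mem_image_of_mem g (Finset.mem_univ p))))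

end Finite

/-! ## §2 The chart shift `Ψ(Y) = Y − H(D(Y))` of Proposition 3 in the weighted sizes -/

section Shift

variable {ι κ β' : Type*} {V : Type*} [NormedAddCommGroup V] [NormedSpace ℂ V]
variable (src tgt : κ → ι) (w₀ w₃ : ι → ℝ) (w₁ : κ → ℝ)

/-- **THE CHART SHIFT KEEPS THE (115)-SIZE UP TO A FACTOR**: if `size(Y) ≤ r ≤ R₀`, `D` obeys (55) `‖D(Y)(c)‖ ≤ 4C₂r²` for sizes `r < R` with `R₀ < R`, and `H` obeys
(46) `size(HX) ≤ B_H·t` whenever `‖X(c)‖ ≤ t ∀ c`, then `size(Y − H(D Y)) ≤ (1 + 4B_HC₂R₀)·r` (both letters).  Print p. 293: *«if we take all A₁ satisfying (104),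
then the image of the translation is contained in the set of A′ satisfying (77) with 3ε₃ instead of ε₃»*. [cite: Balaban1985Variational, (46)-(47) p.285, (55) p.286, (103)-(104) p.293] -/
theorem size_chartShift_le (H : (β' → V) →ₗ[ℂ] (ι → V)) (D : (ι → V) → (β' → V)) {B_H C₂ R R₀ r : ℝ} (hC₂ : 0 ≤ C₂) (hR₀ : R₀ < R)
    (hH : ∀ (X : β' → V) (t : ℝ), (∀ c, ‖X c‖ ≤ t) →
      (∀ i, w₀ i * ‖H X i‖ ≤ B_H * t) ∧ ∀ p, w₁ p * ‖H X (tgt p) - H X (src p)‖ ≤ B_H * t)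
    (hD : ∀ (Y : ι → V) (r' : ℝ), r' < R → (∀ i, w₀ i * ‖Y i‖ ≤ r') → (∀ p, w₁ p * ‖Y (tgt p) - Y (src p)‖ ≤ r') →
      ∀ c, ‖D Y c‖ ≤ 4 * C₂ * r' ^ 2)
    (Y : ι → V) (hr0 : 0 ≤ r) (hr : r ≤ R₀) (h1 : ∀ i, w₀ i * ‖Y i‖ ≤ r) (h2 : ∀ p, w₁ p * ‖Y (tgt p) - Y (src p)‖ ≤ r)
    (hw₀ : ∀ i, 0 ≤ w₀ i) (hw₁ : ∀ p, 0 ≤ w₁ p) :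
    (∀ i, w₀ i * ‖(Y - H (D Y)) i‖ ≤ (1 + 4 * B_H * C₂ * R₀) * r) ∧
      ∀ p, w₁ p * ‖(Y - H (D Y)) (tgt p) - (Y - H (D Y)) (src p)‖ ≤ (1 + 4 * B_H * C₂ * R₀) * r := by
  have hDY : ∀ c, ‖D Y c‖ ≤ 4 * C₂ * r ^ 2 := hD Y r (lt_of_le_of_lt hr hR₀) h1 h2
  have hDY' : ∀ c, ‖D Y c‖ ≤ 4 * C₂ * R₀ * r := fun c => (hDY c).trans (by
    have : r ^ 2 ≤ R₀ * r := by rw [sq]; exact mul_le_mul_of_nonneg_right hr hr0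
    nlinarith)
  obtain ⟨hH1, hH2⟩ := hH (D Y) (4 * C₂ * R₀ * r) hDY'
  refine ⟨fun i => ?_, fun p => ?_⟩
  · calc w₀ i * ‖(Y - H (D Y)) i‖ = w₀ i * ‖Y i - H (D Y) i‖ := rfl
      _ ≤ w₀ i * (‖Y i‖ + ‖H (D Y) i‖) := mul_le_mul_of_nonneg_left (norm_sub_le _ _) (hw₀ i)
      _ = w₀ i * ‖Y i‖ + w₀ i * ‖H (D Y) i‖ := mul_add _ _ _
      _ ≤ r + B_H * (4 * C₂ * R₀ * r) := add_le_add (h1 i) (hH1 i)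
      _ = (1 + 4 * B_H * C₂ * R₀) * r := by ring
  · have e : (Y - H (D Y)) (tgt p) - (Y - H (D Y)) (src p) = (Y (tgt p) - Y (src p)) - (H (D Y) (tgt p) - H (D Y) (src p)) := by
      simp only [Pi.sub_apply]; abel
    rw [e]
    calc w₁ p * ‖(Y (tgt p) - Y (src p)) - (H (D Y) (tgt p) - H (D Y) (src p))‖
        ≤ w₁ p * (‖Y (tgt p) - Y (src p)‖ + ‖H (D Y) (tgt p) - H (D Y) (src p)‖) := mul_le_mul_of_nonneg_left (norm_sub_le _ _) (hw₁ p)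
      _ = w₁ p * ‖Y (tgt p) - Y (src p)‖ + w₁ p * ‖H (D Y) (tgt p) - H (D Y) (src p)‖ := mul_add _ _ _
      _ ≤ r + B_H * (4 * C₂ * R₀ * r) := add_le_add (h2 p) (hH2 p)
      _ = (1 + 4 * B_H * C₂ * R₀) * r := by ring

/-- **THE CHART SHIFT MAPS THE OPEN (115)-BALL OF RADIUS `a₃` INTO THE OPEN BALL OF RADIUS `a₀`** when `(1 + 4B_HC₂R₀)·a₃ ≤ a₀`, `0 < a₃ ≤ R₀ < R` (finite index
types: an open size bound is a closed one at a smaller radius, `exists_size_lt`). [cite: Balaban1985Variational, (77) p.290, (103)-(104) p.293] -/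
theorem mapsTo_chartShift [Fintype ι] [Fintype κ] (H : (β' → V) →ₗ[ℂ] (ι → V)) (D : (ι → V) → (β' → V)) {B_H C₂ R R₀ a₃ a₀ : ℝ}
    (hB_H : 0 ≤ B_H) (hC₂ : 0 ≤ C₂) (hR₀0 : 0 ≤ R₀) (hR₀ : R₀ < R) (ha₃0 : 0 < a₃) (ha₃ : a₃ ≤ R₀) (hθ : (1 + 4 * B_H * C₂ * R₀) * a₃ ≤ a₀)
    (hH : ∀ (X : β' → V) (t : ℝ), (∀ c, ‖X c‖ ≤ t) →
      (∀ i, w₀ i * ‖H X i‖ ≤ B_H * t) ∧ ∀ p, w₁ p * ‖H X (tgt p) - H X (src p)‖ ≤ B_H * t)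
    (hD : ∀ (Y : ι → V) (r' : ℝ), r' < R → (∀ i, w₀ i * ‖Y i‖ ≤ r') → (∀ p, w₁ p * ‖Y (tgt p) - Y (src p)‖ ≤ r') →
      ∀ c, ‖D Y c‖ ≤ 4 * C₂ * r' ^ 2)
    (hw₀ : ∀ i, 0 ≤ w₀ i) (hw₁ : ∀ p, 0 ≤ w₁ p) :
    MapsTo (fun Y : ι → V => Y - H (D Y))
      {Y : ι → V | (∀ i, w₀ i * ‖Y i‖ < a₃) ∧ ∀ p, w₁ p * ‖Y (tgt p) - Y (src p)‖ < a₃}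
      {Y : ι → V | (∀ i, w₀ i * ‖Y i‖ < a₀) ∧ ∀ p, w₁ p * ‖Y (tgt p) - Y (src p)‖ < a₀} := by
  intro Y hY
  obtain ⟨r, hra, hf, hg⟩ := exists_size_lt (fun i => w₀ i * ‖Y i‖) (fun p => w₁ p * ‖Y (tgt p) - Y (src p)‖) hY.1 hY.2
  set r' : ℝ := max r 0 with hr'
  have hr'a : r' < a₃ := max_lt hra ha₃0
  have hθ1 : (0 : ℝ) < 1 + 4 * B_H * C₂ * R₀ := by positivity
  have h := size_chartShift_le src tgt w₀ w₁ H D hC₂ hR₀ hH hD Y (le_max_right _ _) (hr'a.le.trans ha₃)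
    (fun i => (hf i).trans (le_max_left _ _)) (fun p => (hg p).trans (le_max_left _ _)) hw₀ hw₁
  have hlt : (1 + 4 * B_H * C₂ * R₀) * r' < a₀ := lt_of_lt_of_le (mul_lt_mul_of_pos_left hr'a hθ1) hθ
  exact ⟨fun i => (h.1 i).trans_lt hlt, fun p => (h.2 p).trans_lt hlt⟩

/-- The chart shift `Y ↦ Y − H(D(Y))` is holomorphic wherever `D` is (`H` linear on a finite-dimensional space). [cite: Balaban1985Variational, Prop. 3 p.289, (80) p.290] -/
theorem differentiableOn_chartShift [Fintype ι] [Fintype β'] [FiniteDimensional ℂ V] (H : (β' → V) →ₗ[ℂ] (ι → V)) (D : (ι → V) → (β' → V))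
    {s : Set (ι → V)} (hD : DifferentiableOn ℂ D s) : DifferentiableOn ℂ (fun Y : ι → V => Y - H (D Y)) s := by
  have hH : Differentiable ℂ (fun X : β' → V => H X) := (LinearMap.toContinuousLinearMap H).differentiable
  exact differentiableOn_id.sub (hH.comp_differentiableOn hD)

end Shift

/-! ## §3 (98) and holomorphy for the dressed gradient `W = W₀ ∘ (1 − HD) + E` -/

section Dressing

variable {ι κ β' : Type*} {V : Type*} [NormedAddCommGroup V] [NormedSpace ℂ V]
variable (src tgt : κ → ι) (w₀ w₃ : ι → ℝ) (w₁ : κ → ℝ)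

/-- **PROPOSITION 4's (98) FOR THE DRESSED GRADIENT** `W(Y) = W₀(Y − H(D Y)) + E(Y)`: from (98) for the pure-action gradient `W₀` (constant `C₀` below the radius `a₀`;
P3b `FlatProp4Bg1.exists_gradient_prop4_bg1(_T3)`), the letters (46) of `H` and (55) of `D` (pillars P2∕P3a, F4 `chart47W`), and a quadratic letter `C_E` below `R` for the
sum `E` of the (85)–(89) gradients, we get `w₃(i)‖W(Y)(i)‖ ≤ (C₀(1 + 4B_HC₂R₀)² + C_E)·r²` for every `Y` of size `≤ r < a₃`, at any radius `a₃ ≤ R₀ < R` with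
`(1 + 4B_HC₂R₀)a₃ ≤ a₀` — EXACTLY the `hWq` shape of `FlatSmallSolution158Levels.existsUnique_smallSolution158W`. [cite: Balaban1985Variational, Prop. 4 (97)-(98) pp.292-293, (80)-(89) pp.290-291] -/
theorem hWq_of_dressing (W W₀ E : (ι → V) → (ι → V)) (H : (β' → V) →ₗ[ℂ] (ι → V)) (D : (ι → V) → (β' → V))
    {C₀ a₀ C_E B_H C₂ R R₀ a₃ : ℝ} (hW : ∀ Y, W Y = W₀ (Y - H (D Y)) + E Y)
    (hW₀ : ∀ (Y : ι → V) (r : ℝ), r < a₀ → (∀ i, w₀ i * ‖Y i‖ ≤ r) → (∀ p, w₁ p * ‖Y (tgt p) - Y (src p)‖ ≤ r) →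
      ∀ i, w₃ i * ‖W₀ Y i‖ ≤ C₀ * r ^ 2)
    (hH : ∀ (X : β' → V) (t : ℝ), (∀ c, ‖X c‖ ≤ t) →
      (∀ i, w₀ i * ‖H X i‖ ≤ B_H * t) ∧ ∀ p, w₁ p * ‖H X (tgt p) - H X (src p)‖ ≤ B_H * t)
    (hD : ∀ (Y : ι → V) (r' : ℝ), r' < R → (∀ i, w₀ i * ‖Y i‖ ≤ r') → (∀ p, w₁ p * ‖Y (tgt p) - Y (src p)‖ ≤ r') →
      ∀ c, ‖D Y c‖ ≤ 4 * C₂ * r' ^ 2)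
    (hE : ∀ (Y : ι → V) (r : ℝ), r < R → (∀ i, w₀ i * ‖Y i‖ ≤ r) → (∀ p, w₁ p * ‖Y (tgt p) - Y (src p)‖ ≤ r) →
      ∀ i, w₃ i * ‖E Y i‖ ≤ C_E * r ^ 2)
    (hB_H : 0 ≤ B_H) (hC₂ : 0 ≤ C₂) (hR₀0 : 0 ≤ R₀) (hR₀ : R₀ < R) (ha₃ : a₃ ≤ R₀) (hθ : (1 + 4 * B_H * C₂ * R₀) * a₃ ≤ a₀)
    (hw₀ : ∀ i, 0 ≤ w₀ i) (hw₁ : ∀ p, 0 ≤ w₁ p) (hw₃ : ∀ i, 0 ≤ w₃ i) :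
    ∀ (Y : ι → V) (r : ℝ), r < a₃ → (∀ i, w₀ i * ‖Y i‖ ≤ r) → (∀ p, w₁ p * ‖Y (tgt p) - Y (src p)‖ ≤ r) →
      ∀ i, w₃ i * ‖W Y i‖ ≤ (C₀ * (1 + 4 * B_H * C₂ * R₀) ^ 2 + C_E) * r ^ 2 := by
  intro Y r hr h1 h2 i
  have hr0 : 0 ≤ r := (mul_nonneg (hw₀ i) (norm_nonneg _)).trans (h1 i)
  have hθ1 : (0 : ℝ) < 1 + 4 * B_H * C₂ * R₀ := by positivity
  have hshift := size_chartShift_le src tgt w₀ w₁ H D hC₂ hR₀ hH hD Y hr0 (hr.le.trans ha₃) h1 h2 hw₀ hw₁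
  have hlt : (1 + 4 * B_H * C₂ * R₀) * r < a₀ := lt_of_lt_of_le (mul_lt_mul_of_pos_left hr hθ1) hθ
  have hW₀b := hW₀ (Y - H (D Y)) ((1 + 4 * B_H * C₂ * R₀) * r) hlt hshift.1 hshift.2 i
  have hEb := hE Y r (lt_of_lt_of_le hr (ha₃.trans hR₀.le)) h1 h2 i
  rw [hW Y, Pi.add_apply]
  calc w₃ i * ‖W₀ (Y - H (D Y)) i + E Y i‖ ≤ w₃ i * (‖W₀ (Y - H (D Y)) i‖ + ‖E Y i‖) := mul_le_mul_of_nonneg_left (norm_add_le _ _) (hw₃ i)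
    _ = w₃ i * ‖W₀ (Y - H (D Y)) i‖ + w₃ i * ‖E Y i‖ := mul_add _ _ _
    _ ≤ C₀ * ((1 + 4 * B_H * C₂ * R₀) * r) ^ 2 + C_E * r ^ 2 := add_le_add hW₀b hEb
    _ = (C₀ * (1 + 4 * B_H * C₂ * R₀) ^ 2 + C_E) * r ^ 2 := by ring

/-- **HOLOMORPHY OF THE DRESSED GRADIENT ON THE OPEN (115)-BALL OF RADIUS `a₃`** — the `hWd` shape of `existsUnique_smallSolution158W` — from holomorphy of `W₀` on the
`a₀`-ball (P3b: `W₀` is entire), of `D` on the sup-ball of radius `R` (F4 `chart47W`'s `hCd`), and of `E` on the `a₃`-ball (print: *«The functional derivative of V(A′) is an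
analytic function on this space»*). [cite: Balaban1985Variational, Prop. 4 p.292, (80) p.290] -/
theorem hWd_of_dressing [Fintype ι] [Fintype κ] [Fintype β'] [FiniteDimensional ℂ V] (W W₀ E : (ι → V) → (ι → V)) (H : (β' → V) →ₗ[ℂ] (ι → V))
    (D : (ι → V) → (β' → V)) {a₀ B_H C₂ R R₀ a₃ : ℝ} (hW : ∀ Y, W Y = W₀ (Y - H (D Y)) + E Y)
    (hW₀d : DifferentiableOn ℂ W₀ {Y : ι → V | (∀ i, w₀ i * ‖Y i‖ < a₀) ∧ ∀ p, w₁ p * ‖Y (tgt p) - Y (src p)‖ < a₀})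
    (hH : ∀ (X : β' → V) (t : ℝ), (∀ c, ‖X c‖ ≤ t) →
      (∀ i, w₀ i * ‖H X i‖ ≤ B_H * t) ∧ ∀ p, w₁ p * ‖H X (tgt p) - H X (src p)‖ ≤ B_H * t)
    (hD : ∀ (Y : ι → V) (r' : ℝ), r' < R → (∀ i, w₀ i * ‖Y i‖ ≤ r') → (∀ p, w₁ p * ‖Y (tgt p) - Y (src p)‖ ≤ r') →
      ∀ c, ‖D Y c‖ ≤ 4 * C₂ * r' ^ 2)
    (hDd : DifferentiableOn ℂ D {Y : ι → V | ∀ i, w₀ i * ‖Y i‖ < R})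
    (hEd : DifferentiableOn ℂ E {Y : ι → V | (∀ i, w₀ i * ‖Y i‖ < a₃) ∧ ∀ p, w₁ p * ‖Y (tgt p) - Y (src p)‖ < a₃})
    (hB_H : 0 ≤ B_H) (hC₂ : 0 ≤ C₂) (hR₀0 : 0 ≤ R₀) (hR₀ : R₀ < R) (ha₃0 : 0 < a₃) (ha₃ : a₃ ≤ R₀) (hθ : (1 + 4 * B_H * C₂ * R₀) * a₃ ≤ a₀)
    (hw₀ : ∀ i, 0 ≤ w₀ i) (hw₁ : ∀ p, 0 ≤ w₁ p) :
    DifferentiableOn ℂ W {Y : ι → V | (∀ i, w₀ i * ‖Y i‖ < a₃) ∧ ∀ p, w₁ p * ‖Y (tgt p) - Y (src p)‖ < a₃} := by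
  have hWfun : W = fun Y => W₀ (Y - H (D Y)) + E Y := funext hW
  have hsub : {Y : ι → V | (∀ i, w₀ i * ‖Y i‖ < a₃) ∧ ∀ p, w₁ p * ‖Y (tgt p) - Y (src p)‖ < a₃} ⊆ {Y : ι → V | ∀ i, w₀ i * ‖Y i‖ < R} :=
    fun Y hY i => lt_of_lt_of_le (hY.1 i) (ha₃.trans hR₀.le)
  have hΨ : DifferentiableOn ℂ (fun Y : ι → V => Y - H (D Y))
      {Y : ι → V | (∀ i, w₀ i * ‖Y i‖ < a₃) ∧ ∀ p, w₁ p * ‖Y (tgt p) - Y (src p)‖ < a₃} :=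
    differentiableOn_chartShift H D (hDd.mono hsub)
  have hmaps := mapsTo_chartShift src tgt w₀ w₁ H D hB_H hC₂ hR₀0 hR₀ ha₃0 ha₃ hθ hH hD hw₀ hw₁
  rw [hWfun]
  exact (hW₀d.comp hΨ hmaps).add hEd

end Dressing

/-! ## §4 At the d = 3 carrier: P3b's pure-action gradient dressed, in the shapes of `existsUnique_smallSolution158_T3` -/

section T3

open T3ContinuumYM3Torus (T3Family)
open Summit.QuantumFields.YangMills.Theorems.FlatProp4Bg1 (exists_gradient_prop4_bg1_T3)

/-- **PILLAR P3b DRESSED, AT THE d = 3 CARRIER OF `T3Thm1Carrier.varProblem3 F n K`** (fine torus `PBond (F.P K) 0`, `η = L^{−(K−n)}`, one level: `w₀ = w₃ = 1`, `w₁ = L^{K−n}`): for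
EVERY member `F` and heights `n, K`, and ANY chart data — `H` with the two (46)-letters `B_H`, `D` with (55) below `R` and holomorphic on the sup-ball of radius `R`, a dressing `E`
with a quadratic letter `C_E` below `R` and holomorphic on the `a₃`-ball, `0 < R₀ < R`, `a₃ := min{R₀, 1/(4(1 + 4B_HC₂R₀))}` — there are the pure-action gradient `W₀` of P3b
(`exists_gradient_prop4_bg1_T3`: the (grad) identity for `𝒱_η`, entire, (98) with `a₀ = ½`, `C₀ = 18000`) and the dressed `W = W₀ ∘ (1 − HD) + E` with `hWq` (constant
`18000(1 + 4B_HC₂R₀)² + C_E`, radius `a₃`) and `hWd` LITERALLY as consumed by `FlatSmallSolution158.existsUnique_smallSolution158_T3`; no constant depends on `F`, `n`, `K`.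
[cite: Balaban1985Variational, Prop. 4 (97)-(98) pp.292-293, (80)-(89) pp.290-291, (157)-(158) p.302] -/
theorem exists_dressed_gradient_T3 (F : T3Family) (n K : ℕ) {β' : Type*} [Fintype β']
    (H : (β' → Matrix (Fin 2) (Fin 2) ℂ) →ₗ[ℂ] (PBond (F.P K) 0 → Matrix (Fin 2) (Fin 2) ℂ))
    (D : (PBond (F.P K) 0 → Matrix (Fin 2) (Fin 2) ℂ) → (β' → Matrix (Fin 2) (Fin 2) ℂ))
    (E : (PBond (F.P K) 0 → Matrix (Fin 2) (Fin 2) ℂ) → (PBond (F.P K) 0 → Matrix (Fin 2) (Fin 2) ℂ))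
    {B_H C₂ R R₀ C_E : ℝ} (hB_H : 0 ≤ B_H) (hC₂ : 0 ≤ C₂) (hR₀0 : 0 < R₀) (hR₀ : R₀ < R)
    (hH : ∀ (X : β' → Matrix (Fin 2) (Fin 2) ℂ) (t : ℝ), (∀ c, ‖X c‖ ≤ t) →
      (∀ b, ‖H X b‖ ≤ B_H * t) ∧
        ∀ (s : Site (F.P K) 0) (μ ν : Fin 3), (F.L : ℝ) ^ (K - n) * ‖H X ⟨s.shift ν, μ⟩ - H X ⟨s, μ⟩‖ ≤ B_H * t)
    (hD : ∀ (Y : PBond (F.P K) 0 → Matrix (Fin 2) (Fin 2) ℂ) (r : ℝ), r < R → (∀ b, ‖Y b‖ ≤ r) →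
      (∀ (s : Site (F.P K) 0) (μ ν : Fin 3), (F.L : ℝ) ^ (K - n) * ‖Y ⟨s.shift ν, μ⟩ - Y ⟨s, μ⟩‖ ≤ r) → ∀ c, ‖D Y c‖ ≤ 4 * C₂ * r ^ 2)
    (hDd : DifferentiableOn ℂ D {Y : PBond (F.P K) 0 → Matrix (Fin 2) (Fin 2) ℂ | ∀ b, ‖Y b‖ < R})
    (hE : ∀ (Y : PBond (F.P K) 0 → Matrix (Fin 2) (Fin 2) ℂ) (r : ℝ), r < R → (∀ b, ‖Y b‖ ≤ r) →
      (∀ (s : Site (F.P K) 0) (μ ν : Fin 3), (F.L : ℝ) ^ (K - n) * ‖Y ⟨s.shift ν, μ⟩ - Y ⟨s, μ⟩‖ ≤ r) → ∀ b, ‖E Y b‖ ≤ C_E * r ^ 2)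
    (hEd : DifferentiableOn ℂ E {Y : PBond (F.P K) 0 → Matrix (Fin 2) (Fin 2) ℂ | (∀ b, ‖Y b‖ < min R₀ (1 / (4 * (1 + 4 * B_H * C₂ * R₀)))) ∧
      ∀ (s : Site (F.P K) 0) (μ ν : Fin 3), (F.L : ℝ) ^ (K - n) * ‖Y ⟨s.shift ν, μ⟩ - Y ⟨s, μ⟩‖ < min R₀ (1 / (4 * (1 + 4 * B_H * C₂ * R₀)))}) :
    ∃ W₀ W : (PBond (F.P K) 0 → Matrix (Fin 2) (Fin 2) ℂ) → (PBond (F.P K) 0 → Matrix (Fin 2) (Fin 2) ℂ),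
      (∀ A δ : PBond (F.P K) 0 → Matrix (Fin 2) (Fin 2) ℂ, fderiv ℂ (fun A : PBond (F.P K) 0 → Matrix (Fin 2) (Fin 2) ℂ => ∑ p : Plaq (F.P K) 0, (1 - (2 : ℂ)⁻¹ * Matrix.trace (NormedSpace.exp ((Complex.I * (((((F.L : ℝ)⁻¹) ^ (K - n) : ℝ)) : ℂ)) • A ⟨p.src, p.μ⟩) * NormedSpace.exp ((Complex.I * (((((F.L : ℝ)⁻¹) ^ (K - n) : ℝ)) : ℂ)) • A ⟨p.src.shift p.μ, p.ν⟩) * NormedSpace.exp (-((Complex.I * (((((F.L : ℝ)⁻¹) ^ (K - n) : ℝ)) : ℂ)) • A ⟨p.src.shift p.ν, p.μ⟩)) * NormedSpace.exp (-((Complex.I * (((((F.L : ℝ)⁻¹) ^ (K - n) : ℝ)) : ℂ)) • A ⟨p.src, p.ν⟩))) + (2 : ℂ)⁻¹ * Matrix.trace (((Complex.I * (((((F.L : ℝ)⁻¹) ^ (K - n) : ℝ)) : ℂ)) • A ⟨p.src, p.μ⟩) + ((Complex.I * (((((F.L : ℝ)⁻¹) ^ (K - n) : ℝ)) : ℂ))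 • A ⟨p.src.shift p.μ, p.ν⟩) + (-((Complex.I * (((((F.L : ℝ)⁻¹) ^ (K - n) : ℝ)) : ℂ)) • A ⟨p.src.shift p.ν, p.μ⟩)) + (-((Complex.I * (((((F.L : ℝ)⁻¹) ^ (K - n) : ℝ)) : ℂ)) • A ⟨p.src, p.ν⟩))) + (4 : ℂ)⁻¹ * Matrix.trace ((((Complex.I * (((((F.L : ℝ)⁻¹) ^ (K - n) : ℝ)) : ℂ)) • A ⟨p.src, p.μ⟩) + ((Complex.I * (((((F.L : ℝ)⁻¹) ^ (K - n) : ℝ)) : ℂ)) • A ⟨p.src.shift p.μ, p.ν⟩) + (-((Complex.I * (((((F.L : ℝ)⁻¹) ^ (K - n) : ℝ)) : ℂ)) • A ⟨p.src.shift p.ν, p.μ⟩)) + (-((Complex.I * (((((F.L : ℝ)⁻¹) ^ (K - n) : ℝ)) : ℂ)) • A ⟨p.src, p.ν⟩))) ^ 2))) A δ =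
        ((((F.L : ℝ)⁻¹) ^ (K - n) : ℝ) : ℂ) ^ 4 * ∑ b : PBond (F.P K) 0, Matrix.trace (W₀ A b * δ b)) ∧
      Differentiable ℂ W₀ ∧
      (∀ Y, W Y = W₀ (Y - H (D Y)) + E Y) ∧
      (∀ (Y : PBond (F.P K) 0 → Matrix (Fin 2) (Fin 2) ℂ) (r : ℝ), r < min R₀ (1 / (4 * (1 + 4 * B_H * C₂ * R₀))) → (∀ b, ‖Y b‖ ≤ r) →
        (∀ (s : Site (F.P K) 0) (μ ν : Fin 3), (F.L : ℝ) ^ (K - n) * ‖Y ⟨s.shift ν, μ⟩ - Y ⟨s, μ⟩‖ ≤ r) →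
          ∀ b, ‖W Y b‖ ≤ (18000 * (1 + 4 * B_H * C₂ * R₀) ^ 2 + C_E) * r ^ 2) ∧
      DifferentiableOn ℂ W {Y : PBond (F.P K) 0 → Matrix (Fin 2) (Fin 2) ℂ | (∀ b, ‖Y b‖ < min R₀ (1 / (4 * (1 + 4 * B_H * C₂ * R₀)))) ∧
        ∀ (s : Site (F.P K) 0) (μ ν : Fin 3), (F.L : ℝ) ^ (K - n) * ‖Y ⟨s.shift ν, μ⟩ - Y ⟨s, μ⟩‖ < min R₀ (1 / (4 * (1 + 4 * B_H * C₂ * R₀)))} := by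
  obtain ⟨W₀, -, hgrad, hW₀d, hW₀q⟩ := exists_gradient_prop4_bg1_T3 F n K
  set θ : ℝ := 1 + 4 * B_H * C₂ * R₀ with hθdef
  set a₃ : ℝ := min R₀ (1 / (4 * θ)) with ha₃def
  have hθ1 : 1 ≤ θ := by rw [hθdef]; nlinarith [mul_nonneg (mul_nonneg hB_H hC₂) hR₀0.le]
  have hθ0 : 0 < θ := by linarith
  have ha₃0 : 0 < a₃ := lt_min hR₀0 (by positivity)
  have ha₃R₀ : a₃ ≤ R₀ := min_le_left _ _
  have hθa : θ * a₃ ≤ 1 / 2 := by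
    have h1 : θ * a₃ ≤ θ * (1 / (4 * θ)) := mul_le_mul_of_nonneg_left (min_le_right _ _) hθ0.le
    have h2 : θ * (1 / (4 * θ)) = 1 / 4 := by field_simp
    linarith
  -- the generic currency: `ι = PBond`, `κ = PBond × Fin 3`, `src p = p.1`, `tgt p = ⟨p.1₋ + e_ν, μ(p.1)⟩`, `w₀ = w₃ = 1`, `w₁ = L^{K−n}`
  let src : PBond (F.P K) 0 × Fin 3 → PBond (F.P K) 0 := fun p => p.1
  let tgt : PBond (F.P K) 0 × Fin 3 → PBond (F.P K) 0 := fun p => ⟨p.1.src.shift p.2, p.1.dir⟩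
  let W : (PBond (F.P K) 0 → Matrix (Fin 2) (Fin 2) ℂ) → (PBond (F.P K) 0 → Matrix (Fin 2) (Fin 2) ℂ) := fun Y => W₀ (Y - H (D Y)) + E Y
  -- dictionary between the `∀ s μ ν` and the `∀ p` forms of the gradient letters
  have toP : ∀ (Y : PBond (F.P K) 0 → Matrix (Fin 2) (Fin 2) ℂ) (r : ℝ),
      (∀ (s : Site (F.P K) 0) (μ ν : Fin 3), (F.L : ℝ) ^ (K - n) * ‖Y ⟨s.shift ν, μ⟩ - Y ⟨s, μ⟩‖ ≤ r) →
      ∀ p : PBond (F.P K) 0 × Fin 3, (F.L : ℝ) ^ (K - n) * ‖Y (tgt p) - Y (src p)‖ ≤ r := fun Y r h p => h p.1.src p.1.dir p.2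
  have ofP : ∀ (Y : PBond (F.P K) 0 → Matrix (Fin 2) (Fin 2) ℂ) (r : ℝ),
      (∀ p : PBond (F.P K) 0 × Fin 3, (F.L : ℝ) ^ (K - n) * ‖Y (tgt p) - Y (src p)‖ ≤ r) →
      ∀ (s : Site (F.P K) 0) (μ ν : Fin 3), (F.L : ℝ) ^ (K - n) * ‖Y ⟨s.shift ν, μ⟩ - Y ⟨s, μ⟩‖ ≤ r := fun Y r h s μ ν => h (⟨s, μ⟩, ν)
  have toP' : ∀ (Y : PBond (F.P K) 0 → Matrix (Fin 2) (Fin 2) ℂ) (r : ℝ),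
      (∀ (s : Site (F.P K) 0) (μ ν : Fin 3), (F.L : ℝ) ^ (K - n) * ‖Y ⟨s.shift ν, μ⟩ - Y ⟨s, μ⟩‖ < r) →
      ∀ p : PBond (F.P K) 0 × Fin 3, (F.L : ℝ) ^ (K - n) * ‖Y (tgt p) - Y (src p)‖ < r := fun Y r h p => h p.1.src p.1.dir p.2
  have ofP' : ∀ (Y : PBond (F.P K) 0 → Matrix (Fin 2) (Fin 2) ℂ) (r : ℝ),
      (∀ p : PBond (F.P K) 0 × Fin 3, (F.L : ℝ) ^ (K - n) * ‖Y (tgt p) - Y (src p)‖ < r) →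
      ∀ (s : Site (F.P K) 0) (μ ν : Fin 3), (F.L : ℝ) ^ (K - n) * ‖Y ⟨s.shift ν, μ⟩ - Y ⟨s, μ⟩‖ < r := fun Y r h s μ ν => h (⟨s, μ⟩, ν)
  have hLk : (0 : ℝ) ≤ (F.L : ℝ) ^ (K - n) := by positivity
  -- the generic hypotheses at these letters
  have hW₀' : ∀ (Y : PBond (F.P K) 0 → Matrix (Fin 2) (Fin 2) ℂ) (r : ℝ), r < 1 / 2 → (∀ b, (1 : ℝ) * ‖Y b‖ ≤ r) →
      (∀ p : PBond (F.P K) 0 × Fin 3, (F.L : ℝ) ^ (K - n) * ‖Y (tgt p) - Y (src p)‖ ≤ r) → ∀ b, (1 : ℝ) * ‖W₀ Y b‖ ≤ 18000 * r ^ 2 := by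
    intro Y r hr h1 h2 b
    rw [one_mul]
    exact hW₀q Y r hr (fun b => by simpa only [one_mul] using h1 b) (ofP Y r h2) b
  have hH' : ∀ (X : β' → Matrix (Fin 2) (Fin 2) ℂ) (t : ℝ), (∀ c, ‖X c‖ ≤ t) →
      (∀ b, (1 : ℝ) * ‖H X b‖ ≤ B_H * t) ∧ ∀ p : PBond (F.P K) 0 × Fin 3, (F.L : ℝ) ^ (K - n) * ‖H X (tgt p) - H X (src p)‖ ≤ B_H * t := by
    intro X t hX
    exact ⟨fun b => by rw [one_mul]; exact (hH X t hX).1 b, toP _ _ (hH X t hX).2⟩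
  have hD' : ∀ (Y : PBond (F.P K) 0 → Matrix (Fin 2) (Fin 2) ℂ) (r' : ℝ), r' < R → (∀ b, (1 : ℝ) * ‖Y b‖ ≤ r') →
      (∀ p : PBond (F.P K) 0 × Fin 3, (F.L : ℝ) ^ (K - n) * ‖Y (tgt p) - Y (src p)‖ ≤ r') → ∀ c, ‖D Y c‖ ≤ 4 * C₂ * r' ^ 2 :=
    fun Y r' hr' h1 h2 => hD Y r' hr' (fun b => by simpa only [one_mul] using h1 b) (ofP Y r' h2)
  have hE' : ∀ (Y : PBond (F.P K) 0 → Matrix (Fin 2) (Fin 2) ℂ) (r : ℝ), r < R → (∀ b, (1 : ℝ) * ‖Y b‖ ≤ r) →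
      (∀ p : PBond (F.P K) 0 × Fin 3, (F.L : ℝ) ^ (K - n) * ‖Y (tgt p) - Y (src p)‖ ≤ r) → ∀ b, (1 : ℝ) * ‖E Y b‖ ≤ C_E * r ^ 2 := by
    intro Y r hr h1 h2 b
    rw [one_mul]
    exact hE Y r hr (fun b => by simpa only [one_mul] using h1 b) (ofP Y r h2) b
  have hball : ∀ a : ℝ, {Y : PBond (F.P K) 0 → Matrix (Fin 2) (Fin 2) ℂ | (∀ b, (1 : ℝ) * ‖Y b‖ < a) ∧
        ∀ p : PBond (F.P K) 0 × Fin 3, (F.L : ℝ) ^ (K - n) * ‖Y (tgt p) - Y (src p)‖ < a} =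
      {Y : PBond (F.P K) 0 → Matrix (Fin 2) (Fin 2) ℂ | (∀ b, ‖Y b‖ < a) ∧
        ∀ (s : Site (F.P K) 0) (μ ν : Fin 3), (F.L : ℝ) ^ (K - n) * ‖Y ⟨s.shift ν, μ⟩ - Y ⟨s, μ⟩‖ < a} := by
    intro a
    ext Y
    simp only [Set.mem_setOf_eq, one_mul]
    exact ⟨fun h => ⟨h.1, ofP' Y a h.2⟩, fun h => ⟨h.1, toP' Y a h.2⟩⟩
  have hsupball : {Y : PBond (F.P K) 0 → Matrix (Fin 2) (Fin 2) ℂ | ∀ b, (1 : ℝ) * ‖Y b‖ < R} =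
      {Y : PBond (F.P K) 0 → Matrix (Fin 2) (Fin 2) ℂ | ∀ b, ‖Y b‖ < R} := by
    ext Y; simp only [Set.mem_setOf_eq, one_mul]
  have hW₀d' : DifferentiableOn ℂ W₀ {Y : PBond (F.P K) 0 → Matrix (Fin 2) (Fin 2) ℂ | (∀ b, (1 : ℝ) * ‖Y b‖ < 1 / 2) ∧
      ∀ p : PBond (F.P K) 0 × Fin 3, (F.L : ℝ) ^ (K - n) * ‖Y (tgt p) - Y (src p)‖ < 1 / 2} := hW₀d.differentiableOn
  refine ⟨W₀, W, hgrad, hW₀d, fun Y => rfl, ?_, ?_⟩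
  · intro Y r hr h1 h2 b
    have h := hWq_of_dressing src tgt (fun _ => (1 : ℝ)) (fun _ => (1 : ℝ)) (fun _ => (F.L : ℝ) ^ (K - n)) W W₀ E H D (fun Y => rfl)
      hW₀' hH' hD' hE' hB_H hC₂ hR₀0.le hR₀ ha₃R₀ hθa (fun _ => zero_le_one) (fun _ => hLk) (fun _ => zero_le_one) Y r hr
      (fun b => by rw [one_mul]; exact h1 b) (toP Y r h2) b
    rwa [one_mul] at h
  · have h := hWd_of_dressing src tgt (fun _ => (1 : ℝ)) (fun _ => (F.L : ℝ) ^ (K - n)) W W₀ E H D (fun Y => rfl) hW₀d' hH' hD'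
      (by rw [hsupball]; exact hDd) (by rw [hball]; exact hEd) hB_H hC₂ hR₀0.le hR₀ ha₃0 ha₃R₀ hθa (fun _ => zero_le_one) (fun _ => hLk)
    rwa [hball] at h

end T3

end Summit.QuantumFields.YangMills.Theorems.FlatProp4Dressing

end
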